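import Literature.NumberTheory.Adeles.RatFiniteIdeleCongruenceClasses
import Literature.AlgebraicGeometry.ModuliOfAbelianVarieties.SiegelPrincipalLevelNormal
import HarnessLib

/-!
# Reduction modulo `N` of integral finite adèles of `ℚ`: `ẑ → ℤ/Nℤ` with kernel `N·ẑ`, and
# `GL_m(ẑ) → GL_m(ℤ/Nℤ)` / `K_δ(1) → GL_{2g}(ℤ/Nℤ)` with kernel the principal level `K_δ(N)`

Topic `NumberTheory/Adeles`; namespace `Literature.NumberTheory.Adeles`.  THEOREMS ONLY (no definition, no named fact,
no instance, no `sorry`; net Literature debt 0).  Cell hodgecm-mathlib (D-0151), #60 road / M1′ decomposition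
(`B-plan/M1PRIME-DAG.md` ANNEX B §3 row H1 = gap (G3): «the ring hom `𝓞̂ → ℤ/N` with kernel `levelIdeal N` and the induced
`K_δ(1)/K_δ(N) ↪ GSp_δ(ℤ/N)` — ABSENT as a decl»); a banked GENERIC leaf (director s86 (2)(b)).  It feeds the reading of the
integral Hecke operators `γ ∈ K_δ(1) = GSp_δ(ẑ)` on level-`N` structures `η ↦ η ∘ γ̄` ([Deligne1971TravauxShimura] Exemple 4.16,
Prop. 4.17; [Milne2005ShimuraVarieties] §6 p. 70: `K(N)` is the kernel of `G(ẑ) → G(ℤ/Nℤ)`).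
HC_CM is proved only modulo the 7 printed citations until rung 0 closes.

## What is proved (currency: ★ `finAdeleQ = 𝔸_{ℚ,f}`, `ẑ = FiniteAdeleRing.integralAdeles (𝓞 ℚ) ℚ`, ★ `levelIdeal N = N·ẑ`,
## ★ `IsCongOne N A` («`A ≡ 1 (mod N·ẑ)` entrywise»), ★ `principalLevelSubgroup δ N = K_δ(N)`)

Everything is stated WITHOUT introducing a definition: the reduction map is delivered as `∃!` (a consumer `obtain`s it) and all
its properties are proved for EVERY ring hom `ρ : ẑ →+* ZMod N` satisfying the characterising clause
`(∗) ∀ x (a : ℤ), x − a ∈ N·ẑ → ρ x = a`.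
* §1 RESIDUES: two integers congruent to the same integral adèle modulo `N·ẑ` have the same class in `ℤ/Nℤ`, and conversely
  (★ `exists_int_sub_intCast_mem_levelIdeal` «`ẑ = ℤ + N·ẑ`», ★ `int_dvd_sub_of_sub_intCast_mem_levelIdeal`, ★ `intCast_mem_levelIdeal_iff`
  «`ℤ ∩ N·ẑ = Nℤ`»).
* §2 THE REDUCTION HOM: `existsUnique_ringHom_integralAdeles_zmod (hN : N ≠ 0) : ∃! ρ : ẑ →+* ZMod N, (∗)`; for every `ρ` with (∗):
  `ρ x = a ↔ x − a ∈ N·ẑ`, KERNEL `ρ x = 0 ↔ x ∈ N·ẑ`, `ρ a = a` on integers, SURJECTIVITY, and the level change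
  `ZMod.castHom (N ∣ N′) ∘ ρ_{N′}` satisfies (∗) at `N` (hence equals `ρ_N`).
* §3 MATRICES: for `A ∈ M_m(ẑ)` (a matrix over the subring), `IsCongOne N A ↔ A.map ρ = 1`.
* §4 THE GROUP HOM ON `GL_m(ẑ) = {γ ∈ GL_m(𝔸_{ℚ,f}) | γ, γ⁻¹ ∈ M_m(ẑ)}` (Mathlib `Subring.matrix` / `Submonoid.units`, the
  currency of ★ `isCompact_units_matrix_integralAdeles`): `∃ Φ : GL_m(ẑ) →* GL_m(ZMod N)` with entries `(Φ γ) i j = ρ (γ i j)` and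
  `Φ γ = 1 ↔ IsCongOne N γ`; and ON `K_δ(1) = GSp_δ(ẑ)` (whose elements are `ẑ`-integral with integral inverse, ★
  `isIntegral_of_isCongOne_one`): `∃ φ : K_δ(1) →* GL_{2g}(ZMod N)` with the same entry formula and
  **`φ γ = 1 ↔ γ ∈ K_δ(N)`** — `K_δ(N)` is the kernel of reduction mod `N` on `GSp_δ(ẑ)`.
Deliberately NOT here: surjectivity onto `Sp_δ(ℤ/N)`/`GSp_δ(ℤ/N)` (strong approximation, ★ `StrongApproximationSp`), the
multiplier of the image, and `ẑ/Nẑ ≅ ∏_{p ∣ N} ℤ/p^{v_p(N)}` (CRT) — none is needed by the consumers named above.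

## References
* [Deligne1971TravauxShimura] P. Deligne, *Travaux de Shimura*, Sém. Bourbaki 389 (1971), Exemple 4.16 p. 150 («`K(N) = {g ∈ CSp(V̂_ℤ) | g ≡ 1 mod N}`»),
  Prop. 4.17 p. 150.
* [Milne2005ShimuraVarieties] J. S. Milne, *Introduction to Shimura varieties* (2005; 2017 revision), §4 p. 48 (congruence subgroups,
  `ẑ`), §6 p. 70 (`K(N)`).
* [CasselsFrohlichANT1967] J. W. S. Cassels, A. Fröhlich (eds.), *Algebraic Number Theory* (1967), Ch. II §15 (`ℤ ∩ Nẑ = Nℤ`, `ẑ/Nẑ = ℤ/N`).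
-/

set_option autoImplicit false

noncomputable section

open NumberField IsDedekindDomain Matrix
open Literature.AlgebraicGeometry.ModuliOfAbelianVarieties (finAdeleQ levelIdeal mem_levelIdeal_iff
  mem_integralAdeles_of_mem_levelIdeal mul_mem_levelIdeal_of_mem_integralAdeles levelIdeal_anti IsCongOne gspFinAdelic
  principalLevelSubgroup mem_principalLevelSubgroup_iff isIntegral_of_isCongOne_one)

namespace Literature.NumberTheory.Adeles

/-! ### §1. Residues of an integral adèle modulo `N·ẑ` are well defined in `ℤ/Nℤ` -/

/-- Two integer residues of the same finite adèle modulo `N·ẑ` have the same class in `ℤ/Nℤ` (`ℤ ∩ N·ẑ = Nℤ`).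
[cite: CasselsFrohlichANT1967, Ch. II §15] -/
theorem intCast_zmod_eq_of_sub_intCast_mem_levelIdeal {N : ℕ} (hN : N ≠ 0) {w : finAdeleQ} {a a' : ℤ}
    (ha : w - (a : finAdeleQ) ∈ levelIdeal N) (ha' : w - (a' : finAdeleQ) ∈ levelIdeal N) :
    (a : ZMod N) = (a' : ZMod N) :=
  (ZMod.intCast_eq_intCast_iff_dvd_sub a a' N).2 (int_dvd_sub_of_sub_intCast_mem_levelIdeal hN ha ha')

/-- Conversely, an integer in the same class modulo `N` as a residue is again a residue modulo `N·ẑ`.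
[cite: CasselsFrohlichANT1967, Ch. II §15] -/
theorem sub_intCast_mem_levelIdeal_of_intCast_zmod_eq {N : ℕ} (hN : N ≠ 0) {w : finAdeleQ} {a a' : ℤ}
    (ha : w - (a : finAdeleQ) ∈ levelIdeal N) (h : (a : ZMod N) = (a' : ZMod N)) :
    w - (a' : finAdeleQ) ∈ levelIdeal N := by
  have hd : (N : ℤ) ∣ a' - a := (ZMod.intCast_eq_intCast_iff_dvd_sub a a' N).1 h
  have hmem : (((a' - a : ℤ)) : finAdeleQ) ∈ levelIdeal N := (intCast_mem_levelIdeal_iff hN _).2 hd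
  have e : w - (a' : finAdeleQ) = (w - (a : finAdeleQ)) - (((a' - a : ℤ)) : finAdeleQ) := by
    push_cast; ring
  rw [e]
  exact sub_mem ha hmem

/-! ### §2. The reduction homomorphism `ẑ →+* ℤ/Nℤ`: existence, uniqueness, kernel, surjectivity, level change -/

/-- **Existence of the reduction `ẑ → ℤ/Nℤ`** (`N ≠ 0`): a ring homomorphism `ρ` on the integral finite adèles of `ℚ` with
`ρ x = a` whenever `x ≡ a (mod N·ẑ)`, `a ∈ ℤ` — defined by the residue of ★ `exists_int_sub_intCast_mem_levelIdeal` (`ẑ = ℤ + N·ẑ`),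
well defined by §1, additive and multiplicative because `N·ẑ` is an ideal of `ẑ`. [cite: CasselsFrohlichANT1967, Ch. II §15]
[cite: Milne2005ShimuraVarieties, §6 p. 70] -/
theorem exists_ringHom_integralAdeles_zmod {N : ℕ} (hN : N ≠ 0) :
    ∃ ρ : FiniteAdeleRing.integralAdeles (𝓞 ℚ) ℚ →+* ZMod N,
      ∀ (x : FiniteAdeleRing.integralAdeles (𝓞 ℚ) ℚ) (a : ℤ),
        (x : finAdeleQ) - (a : finAdeleQ) ∈ levelIdeal N → ρ x = a := by
  classical
  have hres : ∀ x : FiniteAdeleRing.integralAdeles (𝓞 ℚ) ℚ, ∃ a : ℤ, (x : finAdeleQ) - (a : finAdeleQ) ∈ levelIdeal N :=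
    fun x => exists_int_sub_intCast_mem_levelIdeal hN x.2
  choose r hr using hres
  have key : ∀ (x : FiniteAdeleRing.integralAdeles (𝓞 ℚ) ℚ) (a : ℤ),
      (x : finAdeleQ) - (a : finAdeleQ) ∈ levelIdeal N → ((r x : ℤ) : ZMod N) = a :=
    fun x a ha => intCast_zmod_eq_of_sub_intCast_mem_levelIdeal hN (hr x) ha
  let f : FiniteAdeleRing.integralAdeles (𝓞 ℚ) ℚ → ZMod N := fun x => ((r x : ℤ) : ZMod N)
  have f_one : f 1 = 1 := by
    have h := key 1 1 (by simp)
    simpa using h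
  have f_mul : ∀ x y, f (x * y) = f x * f y := by
    intro x y
    have hxy : ((x * y : FiniteAdeleRing.integralAdeles (𝓞 ℚ) ℚ) : finAdeleQ) - ((r x * r y : ℤ) : finAdeleQ) ∈
        levelIdeal N := by
      have e : ((x * y : FiniteAdeleRing.integralAdeles (𝓞 ℚ) ℚ) : finAdeleQ) - ((r x * r y : ℤ) : finAdeleQ) =
          (x : finAdeleQ) * ((y : finAdeleQ) - (r y : finAdeleQ)) +
            (r y : finAdeleQ) * ((x : finAdeleQ) - (r x : finAdeleQ)) := by
        push_cast; ring
      rw [e]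
      exact add_mem (mul_mem_levelIdeal_of_mem_integralAdeles x.2 (hr y))
        (mul_mem_levelIdeal_of_mem_integralAdeles (intCast_mem_integralAdeles _) (hr x))
    have h := key (x * y) (r x * r y) hxy
    simpa [f, Int.cast_mul] using h
  have f_zero : f 0 = 0 := by
    have h := key 0 0 (by simp)
    simpa using h
  have f_add : ∀ x y, f (x + y) = f x + f y := by
    intro x y
    have hxy : ((x + y : FiniteAdeleRing.integralAdeles (𝓞 ℚ) ℚ) : finAdeleQ) - ((r x + r y : ℤ) : finAdeleQ) ∈
        levelIdeal N := by
      have e : ((x + y : FiniteAdeleRing.integralAdeles (𝓞 ℚ) ℚ) : finAdeleQ) - ((r x + r y : ℤ) : finAdeleQ) =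
          ((x : finAdeleQ) - (r x : finAdeleQ)) + ((y : finAdeleQ) - (r y : finAdeleQ)) := by
        push_cast; ring
      rw [e]
      exact add_mem (hr x) (hr y)
    have h := key (x + y) (r x + r y) hxy
    simpa [f, Int.cast_add] using h
  exact ⟨⟨⟨⟨f, f_one⟩, f_mul⟩, f_zero, f_add⟩, fun x a ha => key x a ha⟩

/-- **Uniqueness**: two ring homomorphisms `ẑ → ℤ/Nℤ` with the residue property agree (every integral adèle has an integer
residue). [cite: CasselsFrohlichANT1967, Ch. II §15] -/
theorem ringHom_integralAdeles_zmod_unique {N : ℕ} (hN : N ≠ 0)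
    {ρ ρ' : FiniteAdeleRing.integralAdeles (𝓞 ℚ) ℚ →+* ZMod N}
    (hρ : ∀ (x : FiniteAdeleRing.integralAdeles (𝓞 ℚ) ℚ) (a : ℤ), (x : finAdeleQ) - (a : finAdeleQ) ∈ levelIdeal N → ρ x = a)
    (hρ' : ∀ (x : FiniteAdeleRing.integralAdeles (𝓞 ℚ) ℚ) (a : ℤ), (x : finAdeleQ) - (a : finAdeleQ) ∈ levelIdeal N → ρ' x = a) :
    ρ = ρ' := by
  refine RingHom.ext fun x => ?_
  obtain ⟨a, ha⟩ := exists_int_sub_intCast_mem_levelIdeal hN x.2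
  rw [hρ x a ha, hρ' x a ha]

/-- **`ẑ/N·ẑ = ℤ/Nℤ` as a homomorphism**: there is EXACTLY ONE ring homomorphism `ρ : ẑ → ℤ/Nℤ` with `ρ x = a` whenever
`x ≡ a (mod N·ẑ)` (`N ≠ 0`). [cite: CasselsFrohlichANT1967, Ch. II §15] [cite: Milne2005ShimuraVarieties, §6 p. 70] -/
theorem existsUnique_ringHom_integralAdeles_zmod {N : ℕ} (hN : N ≠ 0) :
    ∃! ρ : FiniteAdeleRing.integralAdeles (𝓞 ℚ) ℚ →+* ZMod N,
      ∀ (x : FiniteAdeleRing.integralAdeles (𝓞 ℚ) ℚ) (a : ℤ),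
        (x : finAdeleQ) - (a : finAdeleQ) ∈ levelIdeal N → ρ x = a := by
  obtain ⟨ρ, hρ⟩ := exists_ringHom_integralAdeles_zmod hN
  exact ⟨ρ, hρ, fun ρ' hρ' => ringHom_integralAdeles_zmod_unique hN hρ' hρ⟩

section Properties

variable {N : ℕ} {ρ : FiniteAdeleRing.integralAdeles (𝓞 ℚ) ℚ →+* ZMod N}

/-- For a reduction hom, `ρ x = a ↔ x ≡ a (mod N·ẑ)`. [cite: CasselsFrohlichANT1967, Ch. II §15] -/
theorem ringHom_integralAdeles_zmod_apply_eq_intCast_iff (hN : N ≠ 0)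
    (hρ : ∀ (x : FiniteAdeleRing.integralAdeles (𝓞 ℚ) ℚ) (a : ℤ), (x : finAdeleQ) - (a : finAdeleQ) ∈ levelIdeal N → ρ x = a)
    (x : FiniteAdeleRing.integralAdeles (𝓞 ℚ) ℚ) (a : ℤ) :
    ρ x = a ↔ (x : finAdeleQ) - (a : finAdeleQ) ∈ levelIdeal N := by
  refine ⟨fun h => ?_, hρ x a⟩
  obtain ⟨b, hb⟩ := exists_int_sub_intCast_mem_levelIdeal hN x.2
  have hb' : ρ x = b := hρ x b hb
  exact sub_intCast_mem_levelIdeal_of_intCast_zmod_eq hN hb (hb'.symm.trans h)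

/-- **Kernel**: `ρ x = 0 ↔ x ∈ N·ẑ`. [cite: Milne2005ShimuraVarieties, §6 p. 70] [cite: CasselsFrohlichANT1967, Ch. II §15] -/
theorem ringHom_integralAdeles_zmod_apply_eq_zero_iff (hN : N ≠ 0)
    (hρ : ∀ (x : FiniteAdeleRing.integralAdeles (𝓞 ℚ) ℚ) (a : ℤ), (x : finAdeleQ) - (a : finAdeleQ) ∈ levelIdeal N → ρ x = a)
    (x : FiniteAdeleRing.integralAdeles (𝓞 ℚ) ℚ) :
    ρ x = 0 ↔ (x : finAdeleQ) ∈ levelIdeal N := by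
  have h := ringHom_integralAdeles_zmod_apply_eq_intCast_iff hN hρ x 0
  simpa using h

/-- The reduction of the integer adèle `a` is the class of `a`. [cite: CasselsFrohlichANT1967, Ch. II §15] -/
theorem ringHom_integralAdeles_zmod_intCast
    (hρ : ∀ (x : FiniteAdeleRing.integralAdeles (𝓞 ℚ) ℚ) (a : ℤ), (x : finAdeleQ) - (a : finAdeleQ) ∈ levelIdeal N → ρ x = a)
    (a : ℤ) : ρ ⟨(a : finAdeleQ), intCast_mem_integralAdeles a⟩ = a :=
  hρ _ a (by simp)

/-- The reduction of the natural-number adèle `n` is the class of `n`. [cite: CasselsFrohlichANT1967, Ch. II §15] -/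
theorem ringHom_integralAdeles_zmod_natCast
    (hρ : ∀ (x : FiniteAdeleRing.integralAdeles (𝓞 ℚ) ℚ) (a : ℤ), (x : finAdeleQ) - (a : finAdeleQ) ∈ levelIdeal N → ρ x = a)
    (n : ℕ) : ρ ⟨(n : finAdeleQ), natCast_mem _ n⟩ = n := by
  have h := hρ ⟨(n : finAdeleQ), natCast_mem _ n⟩ (n : ℤ) (by simp)
  simpa using h

/-- **Surjectivity** of `ẑ → ℤ/Nℤ` (already `ℤ → ℤ/Nℤ` is onto). [cite: CasselsFrohlichANT1967, Ch. II §15] -/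
theorem ringHom_integralAdeles_zmod_surjective
    (hρ : ∀ (x : FiniteAdeleRing.integralAdeles (𝓞 ℚ) ℚ) (a : ℤ), (x : finAdeleQ) - (a : finAdeleQ) ∈ levelIdeal N → ρ x = a) :
    Function.Surjective ρ := fun c => by
  obtain ⟨a, rfl⟩ := ZMod.intCast_surjective c
  exact ⟨⟨(a : finAdeleQ), intCast_mem_integralAdeles a⟩, ringHom_integralAdeles_zmod_intCast hρ a⟩

/-- **Level change**: for `N ∣ N′` (`N′ ≠ 0`), reducing modulo `N′` and then projecting `ℤ/N′ℤ → ℤ/Nℤ` has the residue property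
at `N` (`N′·ẑ ⊆ N·ẑ`), hence IS the reduction modulo `N` by uniqueness. [cite: Deligne1971TravauxShimura, 1.8 p. 129 and Exemple 4.16 p. 150] -/
theorem castHom_comp_ringHom_integralAdeles_zmod {N' : ℕ} (hN' : N' ≠ 0) (h : N ∣ N')
    {ρ' : FiniteAdeleRing.integralAdeles (𝓞 ℚ) ℚ →+* ZMod N'}
    (hρ' : ∀ (x : FiniteAdeleRing.integralAdeles (𝓞 ℚ) ℚ) (a : ℤ), (x : finAdeleQ) - (a : finAdeleQ) ∈ levelIdeal N' → ρ' x = a)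
    (x : FiniteAdeleRing.integralAdeles (𝓞 ℚ) ℚ) (a : ℤ) (ha : (x : finAdeleQ) - (a : finAdeleQ) ∈ levelIdeal N) :
    (ZMod.castHom h (ZMod N)).comp ρ' x = a := by
  by_cases hN : N = 0
  · subst hN
    obtain rfl : N' = 0 := Nat.eq_zero_of_zero_dvd h
    exact absurd rfl hN'
  obtain ⟨b, hb⟩ := exists_int_sub_intCast_mem_levelIdeal hN' x.2
  rw [RingHom.comp_apply, hρ' x b hb, map_intCast]
  exact intCast_zmod_eq_of_sub_intCast_mem_levelIdeal hN (levelIdeal_anti h hb) ha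

/-- Level change as an equality of homomorphisms: `ZMod.castHom (N ∣ N′) ∘ ρ_{N′} = ρ_N`.
[cite: Deligne1971TravauxShimura, 1.8 p. 129 and Exemple 4.16 p. 150] -/
theorem castHom_comp_ringHom_integralAdeles_zmod_eq {N' : ℕ} (hN' : N' ≠ 0) (h : N ∣ N')
    {ρ' : FiniteAdeleRing.integralAdeles (𝓞 ℚ) ℚ →+* ZMod N'}
    (hρ' : ∀ (x : FiniteAdeleRing.integralAdeles (𝓞 ℚ) ℚ) (a : ℤ), (x : finAdeleQ) - (a : finAdeleQ) ∈ levelIdeal N' → ρ' x = a)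
    (hρ : ∀ (x : FiniteAdeleRing.integralAdeles (𝓞 ℚ) ℚ) (a : ℤ), (x : finAdeleQ) - (a : finAdeleQ) ∈ levelIdeal N → ρ x = a) :
    (ZMod.castHom h (ZMod N)).comp ρ' = ρ := by
  have hN : N ≠ 0 := by
    rintro rfl
    exact hN' (Nat.eq_zero_of_zero_dvd h)
  exact ringHom_integralAdeles_zmod_unique hN (fun x a ha => castHom_comp_ringHom_integralAdeles_zmod hN' h hρ' x a ha) hρ

/-! ### §3. Matrices: `A ≡ 1 (mod N·ẑ)` iff the reduction of `A` is the identity -/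

variable {n : Type} [Fintype n] [DecidableEq n]

omit [Fintype n] in
/-- For a matrix `A` with entries in `ẑ`: **`A ≡ 1 (mod N·ẑ)` iff `A mod N = 1`** in `M_m(ℤ/Nℤ)` (entrywise §2; compare ★
`isCongOne_map_intCast_iff` for INTEGER matrices). [cite: Deligne1971TravauxShimura, Exemple 4.16 p. 150] -/
theorem isCongOne_map_subtype_iff_map_eq_one (hN : N ≠ 0)
    (hρ : ∀ (x : FiniteAdeleRing.integralAdeles (𝓞 ℚ) ℚ) (a : ℤ), (x : finAdeleQ) - (a : finAdeleQ) ∈ levelIdeal N → ρ x = a)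
    (A : Matrix n n (FiniteAdeleRing.integralAdeles (𝓞 ℚ) ℚ)) :
    IsCongOne N (A.map (FiniteAdeleRing.integralAdeles (𝓞 ℚ) ℚ).subtype) ↔ A.map ρ = 1 := by
  rw [← Matrix.ext_iff]
  refine forall_congr' fun i => forall_congr' fun j => ?_
  rw [Matrix.sub_apply, Matrix.map_apply, Matrix.map_apply, Subring.coe_subtype]
  by_cases hij : i = j
  · subst hij
    rw [Matrix.one_apply_eq, Matrix.one_apply_eq]
    have h := ringHom_integralAdeles_zmod_apply_eq_intCast_iff hN hρ (A i i) 1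
    simpa using h.symm
  · rw [Matrix.one_apply_ne hij, Matrix.one_apply_ne hij, ringHom_integralAdeles_zmod_apply_eq_zero_iff hN hρ (A i j),
      sub_zero]

end Properties

/-! ### §4. The group homomorphisms `GL_m(ẑ) → GL_m(ℤ/Nℤ)` and `K_δ(1) → GL_{2g}(ℤ/Nℤ)`; kernel `K_δ(N)` -/

section Groups

variable {N : ℕ} {ρ : FiniteAdeleRing.integralAdeles (𝓞 ℚ) ℚ →+* ZMod N}
variable {m : Type} [Fintype m] [DecidableEq m]

omit [Fintype m] [DecidableEq m] in
/-- The matrix over the subring `ẑ` underlying an element of `GL_m(ẑ) = {γ | γ, γ⁻¹ ∈ M_m(ẑ)}` (entries with their membership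
proofs), read back in `M_m(𝔸_{ℚ,f})`. [cite: Milne2005ShimuraVarieties, §4 p. 48] -/
theorem map_subtype_of_mem_matrix {A : Matrix m m finAdeleQ}
    (hA : ∀ i j, A i j ∈ FiniteAdeleRing.integralAdeles (𝓞 ℚ) ℚ) :
    (Matrix.of fun i j => (⟨A i j, hA i j⟩ : FiniteAdeleRing.integralAdeles (𝓞 ℚ) ℚ)).map
        (FiniteAdeleRing.integralAdeles (𝓞 ℚ) ℚ).subtype = A := by
  ext i j
  rfl

/-- **`GL_m(ẑ) → GL_m(ℤ/Nℤ)`**: for every reduction hom `ρ` (§2) there is a group homomorphism `Φ` on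
`GL_m(ẑ) = {γ ∈ GL_m(𝔸_{ℚ,f}) | γ, γ⁻¹ ∈ M_m(ẑ)}` reducing the entries, `(Φ γ) i j = ρ (γ i j)`, and
**`Φ γ = 1 ↔ γ ≡ 1 (mod N·ẑ)`**. [cite: Milne2005ShimuraVarieties, §4 p. 48 and §6 p. 70] [cite: Deligne1971TravauxShimura, Exemple 4.16 p. 150] -/
theorem exists_monoidHom_units_matrix_integralAdeles_GL_zmod (hN : N ≠ 0)
    (hρ : ∀ (x : FiniteAdeleRing.integralAdeles (𝓞 ℚ) ℚ) (a : ℤ), (x : finAdeleQ) - (a : finAdeleQ) ∈ levelIdeal N → ρ x = a) :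
    ∃ Φ : (((FiniteAdeleRing.integralAdeles (𝓞 ℚ) ℚ).matrix : Subring (Matrix m m finAdeleQ)).toSubmonoid.units :
        Subgroup (GL m finAdeleQ)) →* GL m (ZMod N),
      (∀ (γ : (((FiniteAdeleRing.integralAdeles (𝓞 ℚ) ℚ).matrix : Subring (Matrix m m finAdeleQ)).toSubmonoid.units :
          Subgroup (GL m finAdeleQ))) (i j : m)
          (h : ((γ : GL m finAdeleQ) : Matrix m m finAdeleQ) i j ∈ FiniteAdeleRing.integralAdeles (𝓞 ℚ) ℚ),
          ((Φ γ : GL m (ZMod N)) : Matrix m m (ZMod N)) i j = ρ ⟨_, h⟩) ∧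
      ∀ γ : (((FiniteAdeleRing.integralAdeles (𝓞 ℚ) ℚ).matrix : Subring (Matrix m m finAdeleQ)).toSubmonoid.units :
          Subgroup (GL m finAdeleQ)),
        Φ γ = 1 ↔ IsCongOne N ((γ : GL m finAdeleQ) : Matrix m m finAdeleQ) := by
  classical
  -- the lift of `γ ∈ GL_m(ẑ)` to a matrix over the subring `ẑ`
  let U : Subgroup (GL m finAdeleQ) :=
    ((FiniteAdeleRing.integralAdeles (𝓞 ℚ) ℚ).matrix : Subring (Matrix m m finAdeleQ)).toSubmonoid.units
  have hU : ∀ γ : U, (∀ i j, ((γ : GL m finAdeleQ) : Matrix m m finAdeleQ) i j ∈ FiniteAdeleRing.integralAdeles (𝓞 ℚ) ℚ) ∧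
      ∀ i j, (((γ : GL m finAdeleQ)⁻¹ : GL m finAdeleQ) : Matrix m m finAdeleQ) i j ∈
        FiniteAdeleRing.integralAdeles (𝓞 ℚ) ℚ :=
    fun γ => (Submonoid.mem_units_iff _ _).1 γ.2
  let lift : U → Matrix m m (FiniteAdeleRing.integralAdeles (𝓞 ℚ) ℚ) :=
    fun γ => Matrix.of fun i j => ⟨((γ : GL m finAdeleQ) : Matrix m m finAdeleQ) i j, (hU γ).1 i j⟩
  let liftInv : U → Matrix m m (FiniteAdeleRing.integralAdeles (𝓞 ℚ) ℚ) :=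
    fun γ => Matrix.of fun i j => ⟨(((γ : GL m finAdeleQ)⁻¹ : GL m finAdeleQ) : Matrix m m finAdeleQ) i j, (hU γ).2 i j⟩
  have hsub : Function.Injective
      (fun B : Matrix m m (FiniteAdeleRing.integralAdeles (𝓞 ℚ) ℚ) =>
        B.map (FiniteAdeleRing.integralAdeles (𝓞 ℚ) ℚ).subtype) :=
    fun B B' h => Matrix.ext fun i j => Subtype.ext (by
      have := congrArg (fun C : Matrix m m finAdeleQ => C i j) h
      simpa [Matrix.map_apply] using this)
  have hlift : ∀ γ : U, (lift γ).map (FiniteAdeleRing.integralAdeles (𝓞 ℚ) ℚ).subtype =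
      ((γ : GL m finAdeleQ) : Matrix m m finAdeleQ) := fun γ => map_subtype_of_mem_matrix (hU γ).1
  have hliftInv : ∀ γ : U, (liftInv γ).map (FiniteAdeleRing.integralAdeles (𝓞 ℚ) ℚ).subtype =
      (((γ : GL m finAdeleQ)⁻¹ : GL m finAdeleQ) : Matrix m m finAdeleQ) := fun γ => map_subtype_of_mem_matrix (hU γ).2
  have lift_mul : ∀ γ γ' : U, lift (γ * γ') = lift γ * lift γ' := fun γ γ' => hsub (by
    show (lift (γ * γ')).map _ = (lift γ * lift γ').map _
    rw [Matrix.map_mul, hlift, hlift, hlift, Subgroup.coe_mul, Units.val_mul])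
  have lift_mul_liftInv : ∀ γ : U, lift γ * liftInv γ = 1 := fun γ => hsub (by
    show (lift γ * liftInv γ).map _ = (1 : Matrix m m (FiniteAdeleRing.integralAdeles (𝓞 ℚ) ℚ)).map _
    rw [Matrix.map_mul, hlift, hliftInv, Units.mul_inv, Matrix.map_one _ (map_zero _) (map_one _)])
  have liftInv_mul_lift : ∀ γ : U, liftInv γ * lift γ = 1 := fun γ => hsub (by
    show (liftInv γ * lift γ).map _ = (1 : Matrix m m (FiniteAdeleRing.integralAdeles (𝓞 ℚ) ℚ)).map _
    rw [Matrix.map_mul, hlift, hliftInv, Units.inv_mul, Matrix.map_one _ (map_zero _) (map_one _)])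
  -- the units of `M_m(ℤ/Nℤ)`
  let F : U → GL m (ZMod N) := fun γ =>
    ⟨(lift γ).map ρ, (liftInv γ).map ρ,
      by rw [← Matrix.map_mul, lift_mul_liftInv, Matrix.map_one ρ (map_zero ρ) (map_one ρ)],
      by rw [← Matrix.map_mul, liftInv_mul_lift, Matrix.map_one ρ (map_zero ρ) (map_one ρ)]⟩
  have F_mul : ∀ γ γ' : U, F (γ * γ') = F γ * F γ' := fun γ γ' => Units.ext (by
    change (lift (γ * γ')).map ρ = (lift γ).map ρ * (lift γ').map ρ
    rw [lift_mul, Matrix.map_mul])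
  refine ⟨MonoidHom.mk' F F_mul, fun γ i j h => rfl, fun γ => ?_⟩
  rw [MonoidHom.mk'_apply]
  constructor
  · intro h
    have h1' : ((F γ : GL m (ZMod N)) : Matrix m m (ZMod N)) = 1 := Units.val_eq_one.2 h
    have h1 : (lift γ).map ρ = 1 := h1'
    have h2 := (isCongOne_map_subtype_iff_map_eq_one hN hρ (lift γ)).2 h1
    rwa [hlift] at h2
  · intro h
    have h1 : IsCongOne N ((lift γ).map (FiniteAdeleRing.integralAdeles (𝓞 ℚ) ℚ).subtype) := by rwa [hlift]
    have h2 := (isCongOne_map_subtype_iff_map_eq_one hN hρ (lift γ)).1 h1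
    exact Units.ext h2

variable {g : ℕ} (δ : Fin g → ℕ)

/-- `K_δ(1) = GSp_δ(ẑ)` lies in `GL_{2g}(ẑ)`: its elements have `ẑ`-integral entries with integral inverse
(★ `isIntegral_of_isCongOne_one`). [cite: Deligne1971TravauxShimura, Exemple 4.16 p. 150] -/
theorem coe_mem_units_matrix_integralAdeles_of_mem_principalLevelSubgroup_one {γ : gspFinAdelic δ}
    (hγ : γ ∈ principalLevelSubgroup δ 1) :
    (γ : GL (Fin g ⊕ Fin g) finAdeleQ) ∈
      (((FiniteAdeleRing.integralAdeles (𝓞 ℚ) ℚ).matrix :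
          Subring (Matrix (Fin g ⊕ Fin g) (Fin g ⊕ Fin g) finAdeleQ)).toSubmonoid.units :
        Subgroup (GL (Fin g ⊕ Fin g) finAdeleQ)) := by
  rw [mem_principalLevelSubgroup_iff] at hγ
  exact Submonoid.mem_units_of_val_mem_inv_val_mem _ (isIntegral_of_isCongOne_one hγ.1)
    (isIntegral_of_isCongOne_one hγ.2)

/-- **`K_δ(N)` is the kernel of reduction modulo `N` on `K_δ(1) = GSp_δ(ẑ)`**: for every reduction hom `ρ` (§2) there is a group
homomorphism `φ : K_δ(1) → GL_{2g}(ℤ/Nℤ)` reducing the entries, `(φ γ) i j = ρ (γ i j)`, with **`φ γ = 1 ↔ γ ∈ K_δ(N)`**.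
(Surjectivity onto `Sp_δ(ℤ/N)`/`GSp_δ(ℤ/N)` — strong approximation — is not asserted.)
[cite: Deligne1971TravauxShimura, Exemple 4.16 p. 150 and Prop. 4.17 p. 150] [cite: Milne2005ShimuraVarieties, §6 p. 70] -/
theorem exists_monoidHom_principalLevelSubgroup_one_GL_zmod (hN : N ≠ 0)
    (hρ : ∀ (x : FiniteAdeleRing.integralAdeles (𝓞 ℚ) ℚ) (a : ℤ), (x : finAdeleQ) - (a : finAdeleQ) ∈ levelIdeal N → ρ x = a) :
    ∃ φ : principalLevelSubgroup δ 1 →* GL (Fin g ⊕ Fin g) (ZMod N),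
      (∀ (γ : principalLevelSubgroup δ 1) (i j : Fin g ⊕ Fin g)
          (h : (((γ : gspFinAdelic δ) : GL (Fin g ⊕ Fin g) finAdeleQ) : Matrix (Fin g ⊕ Fin g) (Fin g ⊕ Fin g) finAdeleQ) i j ∈
            FiniteAdeleRing.integralAdeles (𝓞 ℚ) ℚ),
          ((φ γ : GL (Fin g ⊕ Fin g) (ZMod N)) : Matrix (Fin g ⊕ Fin g) (Fin g ⊕ Fin g) (ZMod N)) i j = ρ ⟨_, h⟩) ∧
      ∀ γ : principalLevelSubgroup δ 1, φ γ = 1 ↔ (γ : gspFinAdelic δ) ∈ principalLevelSubgroup δ N := by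
  obtain ⟨Φ, hΦ, hker⟩ := exists_monoidHom_units_matrix_integralAdeles_GL_zmod (m := Fin g ⊕ Fin g) hN hρ
  -- the inclusion `K_δ(1) → GL_{2g}(ẑ)`
  let U : Subgroup (GL (Fin g ⊕ Fin g) finAdeleQ) :=
    ((FiniteAdeleRing.integralAdeles (𝓞 ℚ) ℚ).matrix :
        Subring (Matrix (Fin g ⊕ Fin g) (Fin g ⊕ Fin g) finAdeleQ)).toSubmonoid.units
  let ι : principalLevelSubgroup δ 1 →* U :=
    MonoidHom.codRestrict ((gspFinAdelic δ).subtype.comp (principalLevelSubgroup δ 1).subtype) U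
      fun γ => coe_mem_units_matrix_integralAdeles_of_mem_principalLevelSubgroup_one δ γ.2
  refine ⟨Φ.comp ι, fun γ i j h => hΦ (ι γ) i j h, fun γ => ?_⟩
  rw [MonoidHom.comp_apply, hker, mem_principalLevelSubgroup_iff]
  constructor
  · intro h
    refine ⟨h, ?_⟩
    -- `γ⁻¹ ≡ 1` from `Φ (ι γ⁻¹) = (Φ (ι γ))⁻¹ = 1`
    have h1 : Φ (ι γ) = 1 := (hker (ι γ)).2 h
    have h2 : Φ (ι γ⁻¹) = 1 := by rw [map_inv, map_inv, h1, inv_one]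
    have h3 := (hker (ι γ⁻¹)).1 h2
    simpa [ι] using h3
  · exact fun h => h.1

/-- **Consumer form (M1PRIME-DAG H2/H3): for `γ ∈ K_δ(1)` and any reduction hom `ρ`, `γ ∈ K_δ(N)` iff EVERY ENTRY of `γ`
reduces to the corresponding entry of the identity matrix** — the inverse-congruence half of `K_δ(N)`'s definition is automatic
on `K_δ(1)` (it is a group homomorphism that is being trivial). [cite: Deligne1971TravauxShimura, Exemple 4.16 p. 150]
[cite: Milne2005ShimuraVarieties, §6 p. 70] -/
theorem mem_principalLevelSubgroup_iff_forall_ringHom_apply_eq (hN : N ≠ 0)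
    (hρ : ∀ (x : FiniteAdeleRing.integralAdeles (𝓞 ℚ) ℚ) (a : ℤ), (x : finAdeleQ) - (a : finAdeleQ) ∈ levelIdeal N → ρ x = a)
    {γ : gspFinAdelic δ} (hγ : γ ∈ principalLevelSubgroup δ 1) :
    γ ∈ principalLevelSubgroup δ N ↔
      ∀ i j : Fin g ⊕ Fin g,
        ρ ⟨((γ : GL (Fin g ⊕ Fin g) finAdeleQ) : Matrix (Fin g ⊕ Fin g) (Fin g ⊕ Fin g) finAdeleQ) i j,
            isIntegral_of_isCongOne_one ((mem_principalLevelSubgroup_iff δ).1 hγ).1 i j⟩ =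
          (1 : Matrix (Fin g ⊕ Fin g) (Fin g ⊕ Fin g) (ZMod N)) i j := by
  obtain ⟨φ, hφ, hker⟩ := exists_monoidHom_principalLevelSubgroup_one_GL_zmod δ hN hρ
  rw [← hker ⟨γ, hγ⟩, ← Units.val_eq_one, ← Matrix.ext_iff]
  refine forall_congr' fun i => forall_congr' fun j => ?_
  rw [hφ ⟨γ, hγ⟩ i j (isIntegral_of_isCongOne_one ((mem_principalLevelSubgroup_iff δ).1 hγ).1 i j)]

end Groups

end Literature.NumberTheory.Adeles
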